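import Literature.AnabelianGeometry.SemiGraphs.TemperedSpecialFibre
import Literature.AnabelianGeometry.SemiGraphs.OncePuncturedTemperedGroupPadicWitness
import Literature.AnabelianGeometry.SemiGraphs.TemperedArithmeticGroupPadicWitness
import Literature.AnabelianGeometry.SemiGraphs.TemperedVerticialNamedFactsProofs
import Literature.AnabelianGeometry.SemiGraphs.Prop36HypothesesWitnessChart
import Literature.AnabelianGeometry.SemiGraphs.TemperedDecompositionCompact
import HarnessLib

/-!
# [SemiAnbd] Cor. 3.11 / Rmk. 3.11.1: a `p`-adic special-fibre model, and the universal closures of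
# the origin-guarded typings `Cor311`, `Rmk3111` are FALSE — FACT-LIST rows F-1721, F-1723

Mochizuki, *Semi-graphs of anabelioids*, Publ. RIMS **42** (2006) [SemiAnbd], Example 3.10 pp. 43–45
(`1 → Δ → Π → G_K → 1`, the special-fibre semi-graph of anabelioids `𝒢^c` and the admissible quotient
`Δ ↠ π₁^temp(𝒢^c)`), Corollary 3.11 pp. 45–49 ("… `p_α = p_β` …") and Remark 3.11.1 p. 49 (the pro-`Σ`
version, with the author's Comments (May 2020) item (3.): `p_α, p_β ∈ Σ`)
[cite: MochizukiSemiAnbd2006, Cor 3.11 pp.45-49].  Proof-only companion to `TemperedSpecialFibre.lean`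
(abc-iut-L3-t2), where both are typed as predicates GUARDED BY ORIGIN CERTIFICATES
(`SpecialFibreOrigin.IsSpecialFibreOf`, `ProSigmaOrigin.IsProSigmaOf` — hypothesis structures "asserted
for no instance"): `Cor311 pα pβ Ωα Ωβ` (FACT-LIST F-1721, inside the [IUTchIII] Cor 3.12 cone as a FACT
node; conditional producer `corollary_3_11_of_steps`, `TemperedSpecialFibreReductions.lean`) and
`Rmk3111 pα pβ Ωα Ωβ` (F-1723).

abc-iut cell, block F (fact-proving wave), plan header rule R1 (ii) (abc-iut-plan 2026-08-26T05:41:23Z):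
for a PARAMETRISED row whose universal closure is false, file the kernel refutation `not_forall_<decl>`
(the render marks it «universal-closure REFUTED / schema; instance forms open or model-witnessed»).
Both typed conclusions contain the clause `pα = pβ`; the certificates are uninterpreted fields; so over
ALL-CERTIFYING junk origins the closures fail as soon as special-fibre data EXIST over `ℚ_2` and `ℚ_3`
with isomorphic geometric parts.  This file records, sorry-free:

1. `TemperedArithmeticGroup.exists_padic_specialFibreModel` — **a `TemperedArithmeticGroup ℚ_p`
   CARRYING a `SpecialFibreData`, for every prime `p`** (new inhabitation record; the tree had such data
   only over algebraically closed fields — `SpecialFibreData.exists_selfModel`, abc-iut-w4-d098 — and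
   `TemperedArithmeticGroup ℚ_p` only with `Δ = 1` or without special-fibre data — abc-iut-w5-d218):
   for a semi-graph of anabelioids `𝒢` satisfying the hypotheses of Thm. 3.7 with tempered chart `c`,
   `Π := π₁^temp(𝒢) × G_{ℚ_p}` with augmentation `pr₂` (GENUINE arithmetic quotient `G_{ℚ_p} = Gal(ℚ̄_p/ℚ_p)`),
   `Δ = π₁^temp(𝒢) × 1`, special fibre `𝒢^c := 𝒢` with chart `c` and admissible quotient `pr₁|_Δ` (an
   isomorphism).  Inputs BY NAME: `IsTempered.prod_of_profinite` / `.subgroup_of_isClosed`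
   (abc-iut-w5-d240 / L3), `isSlimGroup_prod`, `isSlimGroup_of_continuousMulEquiv` (abc-iut-w5-d218),
   `galoisMLF_slim_holds` ([AbsAnab] Thm 1.1.1 (ii), abc-iut-L4), `secondCountableTopology_absoluteGaloisGroup_padic`
   (abc-iut-w5-d218), `ProfiniteSemiGraph.temperedPiSlim_holds` (Prop. 3.6 (iv), abc-iut-L3-t11/d2).
   HONEST LABEL (DEGENERATE aspects): SPLIT extension with trivial outer Galois action, and the special
   fibre is an arbitrary Thm-3.7 graph — not the stable model of a curve over `ℚ_p`; no origin certificate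
   is (or can be) produced under campaign M.
2. `not_forall_cor311` (F-1721) and `not_forall_rmk3111` (F-1723) — with their `∃`-forms
   `exists_not_cor311`, `exists_not_rmk3111`: over `ℚ_2`, `ℚ_3` with all-certifying origins, the models
   of 1. over the SAME graph (`exists_thm37Hypotheses_and_chart`, abc-iut-w5-d212) have
   `Δ_2 ≅ π₁^temp(𝒢) ≅ Δ_3`, resp. trivially isomorphic (trivial) pro-`Σ` quotients for the junk
   quotient data `Ker := ⊤`, `Σ = {2, 3, 5}` — and `2 ≠ 3`.

The instance form that IS a theorem of the tree is cited, not restated: `corollary_3_11_of_steps`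
(`Cor311` from the three named steps S1–S3 of the printed proof).  The INTENDED instance — origin
certificates issued by the stable reduction of actual hyperbolic curves over `p`-adic fields
(FOUNDATIONS rows 13–14: André's tempered `π₁`, stable reduction) — is not constructible in the tree;
there Cor. 3.11 is Mochizuki's theorem and stays a NAMED FACT at that instance.  HONEST FRAMING:
statements about the cell's own certificate-guarded typing (junk certificates + a consistency model);
nothing of [SemiAnbd] is asserted or denied; instantiated ≠ endorsed; nothing here bears on [IUTchIII]
Cor 3.12.
-/

noncomputable section

open Topology TopologicalSpace Function
open Literature.AlgebraicGeometry.Frobenioids (IsSlimGroup)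

namespace Literature.AnabelianGeometry.SemiGraphs

/-! ### A `p`-adic tempered arithmetic group carrying special-fibre data -/

/-- **`TemperedArithmeticGroup ℚ_p` with `SpecialFibreData`, for every prime `p`.**  Given a semi-graph
of anabelioids `𝒢` satisfying the hypotheses of [SemiAnbd] Thm. 3.7 and a tempered chart `c` of `𝒢`:
`Π := π₁^temp(𝒢) × G_{ℚ_p}` (tempered: tempered × profinite; temp-slim: product of slim groups,
Prop. 3.6 (iv) and [AbsAnab] Thm 1.1.1 (ii); Galois-countable), augmentation `pr₂` onto `G_{ℚ_p}`,
`Δ = π₁^temp(𝒢) × 1 ≅ π₁^temp(𝒢)` (tempered, slim), special fibre `(𝒢, c)` with admissible quotient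
`pr₁|_Δ : Δ ⥲ π₁^temp(𝒢)`.  Returned: the datum and an isomorphism `Δ ≅ π₁^temp(𝒢)`.  DEGENERATE
(split, trivial outer action; `𝒢` is not asserted to be a stable-model special fibre).
[cite: MochizukiSemiAnbd2006, Ex 3.10 pp.43-45] -/
theorem TemperedArithmeticGroup.exists_padic_specialFibreModel (p : ℕ) [Fact p.Prime]
    (𝒢 : ProfiniteSemiGraph.{0}) (h37 : 𝒢.Thm37Hypotheses) (c : ProfiniteSemiGraph.TemperedPiChart 𝒢) :
    ∃ (D : TemperedArithmeticGroup ℚ_[p]) (S : SpecialFibreData D),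
      S.Gc = 𝒢 ∧ Nonempty (D.delta ≃ₜ* c.G) := by
  classical
  -- the arithmetic part `G_{ℚ_p}`: profinite, Galois-countable, slim
  haveI : IsGalois ℚ_[p] (AlgebraicClosure ℚ_[p]) := {}
  haveI : CompactSpace (Field.absoluteGaloisGroup ℚ_[p]) := by
    change CompactSpace (AlgebraicClosure ℚ_[p] ≃ₐ[ℚ_[p]] AlgebraicClosure ℚ_[p]); infer_instance
  haveI : T2Space (Field.absoluteGaloisGroup ℚ_[p]) := krullTopology_t2
  haveI : TotallyDisconnectedSpace (Field.absoluteGaloisGroup ℚ_[p]) := by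
    change TotallyDisconnectedSpace (AlgebraicClosure ℚ_[p] ≃ₐ[ℚ_[p]] AlgebraicClosure ℚ_[p])
    infer_instance
  haveI : SecondCountableTopology (Field.absoluteGaloisGroup ℚ_[p]) :=
    secondCountableTopology_absoluteGaloisGroup_padic p
  have hSlimG : IsSlimGroup (Field.absoluteGaloisGroup ℚ_[p]) :=
    Literature.AnabelianGeometry.AbsoluteAnabelian.galoisMLF_slim_holds p ℚ_[p]
  -- the geometric part `π₁^temp(𝒢)`: tempered, Galois-countable, slim (Prop. 3.6 (iv))
  haveI : SecondCountableTopology c.G := c.secondCountableTopology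
  have hSlimC : IsSlimGroup c.G :=
    ProfiniteSemiGraph.temperedPiSlim_holds 𝒢 h37.toProp36Hypotheses c
  -- the product `Π := π₁^temp(𝒢) × G_{ℚ_p}` with augmentation `pr₂`
  let aug : (c.G × Field.absoluteGaloisGroup ℚ_[p]) →ₜ* Field.absoluteGaloisGroup ℚ_[p] :=
    ContinuousMonoidHom.snd _ _
  have haug_mem : ∀ x : c.G × Field.absoluteGaloisGroup ℚ_[p], x ∈ aug.toMonoidHom.ker ↔ x.2 = 1 :=
    fun x => MonoidHom.mem_ker
  have hkerClosed : IsClosed (aug.toMonoidHom.ker : Set (c.G × Field.absoluteGaloisGroup ℚ_[p])) := by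
    rw [MonoidHom.coe_ker]; exact isClosed_singleton.preimage (map_continuous aug)
  -- `Ker aug = π₁^temp(𝒢) × 1 ≃ₜ* π₁^temp(𝒢)`
  let eKer : c.G ≃ₜ* aug.toMonoidHom.ker :=
    { toFun := fun γ => ⟨(γ, 1), (haug_mem _).mpr rfl⟩
      invFun := fun x => x.1.1
      left_inv := fun _ => rfl
      right_inv := fun x => by
        obtain ⟨⟨γ, g⟩, hx⟩ := x
        have hg : g = 1 := (haug_mem _).mp hx
        subst hg; rfl
      map_mul' := fun _ _ => rfl
      continuous_toFun := (continuous_id.prodMk continuous_const).subtype_mk _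
      continuous_invFun := continuous_fst.comp continuous_subtype_val }
  have hT : IsTempered (c.G × Field.absoluteGaloisGroup ℚ_[p]) := c.isTempered.prod_of_profinite
  let D : TemperedArithmeticGroup ℚ_[p] :=
    { Pi := c.G × Field.absoluteGaloisGroup ℚ_[p]
      isTempered := hT
      aug := aug
      aug_surjective := fun g => ⟨(1, g), rfl⟩
      isTempered_ker := hT.subgroup_of_isClosed _ hkerClosed
      isSlimGroup := isSlimGroup_prod hSlimC hSlimG
      isSlimGroup_ker := isSlimGroup_of_continuousMulEquiv eKer hSlimC
      secondCountableTopology := inferInstance }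
  -- the admissible quotient `pr₁|_Δ : Δ ↠ π₁^temp(𝒢)`
  let adm : D.delta →ₜ* c.G :=
    ⟨(MonoidHom.fst c.G (Field.absoluteGaloisGroup ℚ_[p])).comp D.delta.subtype,
      continuous_fst.comp continuous_subtype_val⟩
  let S : SpecialFibreData D :=
    { Gc := 𝒢, hyp := h37, chart := c, admissible := adm,
      admissible_surjective := fun g => ⟨⟨(g, 1), (haug_mem _).mpr rfl⟩, rfl⟩ }
  exact ⟨D, S, rfl, ⟨eKer.symm⟩⟩

/-- **Outright**: for every prime `p` some `TemperedArithmeticGroup ℚ_p` carries special-fibre data (over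
abc-iut-w5-d212's Thm-3.7 witness graph `affWitness 2` with its chart, `exists_thm37Hypotheses_and_chart`).
[cite: MochizukiSemiAnbd2006, Ex 3.10 p.44] -/
theorem SpecialFibreData.exists_padicModel (p : ℕ) [Fact p.Prime] :
    ∃ (D : TemperedArithmeticGroup ℚ_[p]), Nonempty (SpecialFibreData D) := by
  obtain ⟨𝒢, h37, ⟨c⟩⟩ := ProfiniteSemiGraph.exists_thm37Hypotheses_and_chart
  obtain ⟨D, S, -, -⟩ := TemperedArithmeticGroup.exists_padic_specialFibreModel p 𝒢 h37 c
  exact ⟨D, ⟨S⟩⟩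

/-! ### F-1721: `Cor311` — the universal closure over the origin certificates is false -/

/-- **FACT-LIST F-1721, `∃`-form**: there are (all-certifying, junk) special-fibre origins over `ℚ_2` and
`ℚ_3` for which the typed `Cor311 2 3` FAILS: certified special-fibre data over `ℚ_2` and `ℚ_3` with
isomorphic geometric tempered fundamental groups exist (`exists_padic_specialFibreModel` over one graph),
while the typed conclusion asserts `2 = 3`.  Refutes the closure of OUR certificate-guarded typing, not
[SemiAnbd] Cor. 3.11. [cite: MochizukiSemiAnbd2006, Cor 3.11 pp.45-49] -/
theorem exists_not_cor311 :
    ∃ (Ωα : SpecialFibreOrigin ℚ_[2]) (Ωβ : SpecialFibreOrigin ℚ_[3]),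
      ¬ Literature.AnabelianGeometry.SemiGraphs.Cor311 2 3 Ωα Ωβ := by
  obtain ⟨𝒢, h37, ⟨c⟩⟩ := ProfiniteSemiGraph.exists_thm37Hypotheses_and_chart
  obtain ⟨D₂, S₂, -, ⟨e₂⟩⟩ := TemperedArithmeticGroup.exists_padic_specialFibreModel 2 𝒢 h37 c
  obtain ⟨D₃, S₃, -, ⟨e₃⟩⟩ := TemperedArithmeticGroup.exists_padic_specialFibreModel 3 𝒢 h37 c
  refine
    ⟨{ IsOfGeometricOrigin := fun _ => True, IsTateOrigin := fun _ => True,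
       isOfGeometricOrigin_of_isTateOrigin := fun _ _ => trivial,
       IsSpecialFibreOf := fun _ _ => True,
       isOfGeometricOrigin_of_isSpecialFibreOf := fun _ _ _ => trivial },
     { IsOfGeometricOrigin := fun _ => True, IsTateOrigin := fun _ => True,
       isOfGeometricOrigin_of_isTateOrigin := fun _ _ => trivial,
       IsSpecialFibreOf := fun _ _ => True,
       isOfGeometricOrigin_of_isSpecialFibreOf := fun _ _ _ => trivial }, fun h => ?_⟩
  have h23 : (2 : ℕ) = 3 := (h D₂ D₃ S₂ S₃ trivial trivial (e₂.trans e₃.symm)).2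
  omega

/-- **FACT-LIST F-1721 — the universal closure of `Cor311` is FALSE** (schema row: the predicate is
conditionally derivable — `corollary_3_11_of_steps` — and holds vacuously at non-certifying origins, but
fails at the all-certifying junk origins of `exists_not_cor311`). [cite: MochizukiSemiAnbd2006, Cor 3.11 pp.45-49] -/
theorem not_forall_cor311 :
    ¬ ∀ (pα pβ : ℕ) [Fact pα.Prime] [Fact pβ.Prime] (Kα Kβ : Type) [Field Kα] [Field Kβ]
        [Algebra ℚ_[pα] Kα] [FiniteDimensional ℚ_[pα] Kα] [Algebra ℚ_[pβ] Kβ]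
        [FiniteDimensional ℚ_[pβ] Kβ] (Ωα : SpecialFibreOrigin Kα) (Ωβ : SpecialFibreOrigin Kβ),
        Literature.AnabelianGeometry.SemiGraphs.Cor311 pα pβ Ωα Ωβ := by
  intro h
  obtain ⟨Ωα, Ωβ, hn⟩ := exists_not_cor311
  exact hn (h 2 3 ℚ_[2] ℚ_[3] Ωα Ωβ)

/-- Model witness in the other direction: at an origin certifying NOTHING, `Cor311` holds vacuously (for
all residue characteristics) — the typed predicate carries content only through its certificates.
[cite: MochizukiSemiAnbd2006, Cor 3.11 pp.45-49] -/
theorem cor311_of_forall_not_isSpecialFibreOf {Kα Kβ : Type} [Field Kα] [Field Kβ]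
    (pα pβ : ℕ) [Fact pα.Prime] [Fact pβ.Prime] [Algebra ℚ_[pα] Kα] [FiniteDimensional ℚ_[pα] Kα]
    [Algebra ℚ_[pβ] Kβ] [FiniteDimensional ℚ_[pβ] Kβ] (Ωα : SpecialFibreOrigin Kα)
    (Ωβ : SpecialFibreOrigin Kβ) (hα : ∀ D S, ¬ Ωα.IsSpecialFibreOf D S) :
    Literature.AnabelianGeometry.SemiGraphs.Cor311 pα pβ Ωα Ωβ :=
  fun Dα _ Sα _ h _ => (hα Dα Sα h).elim

/-! ### F-1723: `Rmk3111` — the universal closure over the origin certificates is false -/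

/-- **FACT-LIST F-1723, `∃`-form**: there are (all-certifying, junk) pro-`Σ` origins over `ℚ_2` and
`ℚ_3` for which the typed `Rmk3111 2 3` FAILS: with `Σ = {2, 3, 5}` (primes, `|Σ| = 3 ≥ 3`, `2, 3 ∈ Σ`),
certified special-fibre data over `ℚ_2`, `ℚ_3` (`exists_padic_specialFibreModel`) and the junk certified
pro-`Σ` quotient data `Ker := ⊤` (trivial pro-`Σ` quotients, trivially isomorphic), the typed conclusion
asserts `2 = 3`.  Refutes the closure of OUR certificate-guarded typing, not [SemiAnbd] Rmk. 3.11.1.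
[cite: MochizukiSemiAnbd2006, Rmk 3.11.1 p.49] -/
theorem exists_not_rmk3111 :
    ∃ (Ωα : ProSigmaOrigin ℚ_[2]) (Ωβ : ProSigmaOrigin ℚ_[3]),
      ¬ Literature.AnabelianGeometry.SemiGraphs.Rmk3111 2 3 Ωα Ωβ := by
  obtain ⟨𝒢, h37, ⟨c⟩⟩ := ProfiniteSemiGraph.exists_thm37Hypotheses_and_chart
  obtain ⟨D₂, S₂, -, -⟩ := TemperedArithmeticGroup.exists_padic_specialFibreModel 2 𝒢 h37 c
  obtain ⟨D₃, S₃, -, -⟩ := TemperedArithmeticGroup.exists_padic_specialFibreModel 3 𝒢 h37 c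
  refine
    ⟨{ IsOfGeometricOrigin := fun _ => True, IsTateOrigin := fun _ => True,
       isOfGeometricOrigin_of_isTateOrigin := fun _ _ => trivial,
       IsSpecialFibreOf := fun _ _ => True,
       isOfGeometricOrigin_of_isSpecialFibreOf := fun _ _ _ => trivial,
       IsProSigmaOf := fun _ _ _ => True,
       isOfGeometricOrigin_of_isProSigmaOf := fun _ _ _ _ => trivial },
     { IsOfGeometricOrigin := fun _ => True, IsTateOrigin := fun _ => True,
       isOfGeometricOrigin_of_isTateOrigin := fun _ _ => trivial,
       IsSpecialFibreOf := fun _ _ => True,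
       isOfGeometricOrigin_of_isSpecialFibreOf := fun _ _ _ => trivial,
       IsProSigmaOf := fun _ _ _ => True,
       isOfGeometricOrigin_of_isProSigmaOf := fun _ _ _ _ => trivial }, fun h => ?_⟩
  let Sig : Set ℕ := {2, 3, 5}
  have hprime : ∀ q ∈ Sig, q.Prime := by
    intro q hq
    simp only [Sig, Set.mem_insert_iff, Set.mem_singleton_iff] at hq
    rcases hq with rfl | rfl | rfl
    exacts [Nat.prime_two, Nat.prime_three, Nat.prime_five]
  have hcard : (3 : ℕ∞) ≤ Sig.encard := by
    have h3 : Sig.encard = 3 := Set.encard_eq_three.mpr ⟨2, 3, 5, by decide, by decide, by decide, rfl⟩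
    rw [h3]
  -- the junk pro-`Σ` quotient data: everything is killed
  let Q₂ : ProSigmaQuotient D₂ Sig :=
    { ker := ⊤, normal := inferInstance, isClosed := by rw [Subgroup.coe_top]; exact isClosed_univ,
      kerDelta := ⊤, normalDelta := inferInstance,
      isClosed_kerDelta := by rw [Subgroup.coe_top]; exact isClosed_univ,
      kerDelta_le := fun x _ => Subgroup.mem_subgroupOf.mpr (Subgroup.mem_top _) }
  let Q₃ : ProSigmaQuotient D₃ Sig :=
    { ker := ⊤, normal := inferInstance, isClosed := by rw [Subgroup.coe_top]; exact isClosed_univ,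
      kerDelta := ⊤, normalDelta := inferInstance,
      isClosed_kerDelta := by rw [Subgroup.coe_top]; exact isClosed_univ,
      kerDelta_le := fun x _ => Subgroup.mem_subgroupOf.mpr (Subgroup.mem_top _) }
  haveI h₂ : Subsingleton (D₂.delta ⧸ Q₂.kerDelta) := QuotientGroup.subsingleton_quotient_top
  haveI h₃ : Subsingleton (D₃.delta ⧸ Q₃.kerDelta) := QuotientGroup.subsingleton_quotient_top
  let e : (D₂.delta ⧸ Q₂.kerDelta) ≃ₜ* (D₃.delta ⧸ Q₃.kerDelta) :=
    { toFun := fun _ => 1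
      invFun := fun _ => 1
      left_inv := fun _ => Subsingleton.elim _ _
      right_inv := fun _ => Subsingleton.elim _ _
      map_mul' := fun _ _ => Subsingleton.elim _ _
      continuous_toFun := continuous_const
      continuous_invFun := continuous_const }
  have h23 : (2 : ℕ) = 3 :=
    (h Sig hprime hcard (by simp [Sig]) (by simp [Sig]) D₂ D₃ S₂ S₃ Q₂ Q₃ trivial trivial trivial trivial
      ⟨e⟩).2
  omega

/-- **FACT-LIST F-1723 — the universal closure of `Rmk3111` is FALSE** (schema row; fails at the
all-certifying junk origins of `exists_not_rmk3111`). [cite: MochizukiSemiAnbd2006, Rmk 3.11.1 p.49] -/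
theorem not_forall_rmk3111 :
    ¬ ∀ (pα pβ : ℕ) [Fact pα.Prime] [Fact pβ.Prime] (Kα Kβ : Type) [Field Kα] [Field Kβ]
        [Algebra ℚ_[pα] Kα] [FiniteDimensional ℚ_[pα] Kα] [Algebra ℚ_[pβ] Kβ]
        [FiniteDimensional ℚ_[pβ] Kβ] (Ωα : ProSigmaOrigin Kα) (Ωβ : ProSigmaOrigin Kβ),
        Literature.AnabelianGeometry.SemiGraphs.Rmk3111 pα pβ Ωα Ωβ := by
  intro h
  obtain ⟨Ωα, Ωβ, hn⟩ := exists_not_rmk3111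
  exact hn (h 2 3 ℚ_[2] ℚ_[3] Ωα Ωβ)

/-- Model witness in the other direction: at an origin certifying no special-fibre data, `Rmk3111` holds
vacuously. [cite: MochizukiSemiAnbd2006, Rmk 3.11.1 p.49] -/
theorem rmk3111_of_forall_not_isSpecialFibreOf {Kα Kβ : Type} [Field Kα] [Field Kβ]
    (pα pβ : ℕ) [Fact pα.Prime] [Fact pβ.Prime] [Algebra ℚ_[pα] Kα] [FiniteDimensional ℚ_[pα] Kα]
    [Algebra ℚ_[pβ] Kβ] [FiniteDimensional ℚ_[pβ] Kβ] (Ωα : ProSigmaOrigin Kα)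
    (Ωβ : ProSigmaOrigin Kβ) (hα : ∀ D S, ¬ Ωα.IsSpecialFibreOf D S) :
    Literature.AnabelianGeometry.SemiGraphs.Rmk3111 pα pβ Ωα Ωβ :=
  fun _ _ _ _ _ Dα _ Sα _ _ _ h _ _ _ _ => (hα Dα Sα h).elim

end Literature.AnabelianGeometry.SemiGraphs

end
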